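import Summits.QuantumFields.BalabanUV.Beta.GAN24.StaircaseLaplacianDefect

/-!
# G-an2-4 ∕ (CONV-C), road P2, route R2-S1, VECTOR LAYER — THE GRADIENT AND DIVERGENCE BRICKS: Bałaban's `∂` (scalar → vector,
# `B5Action121.GradOp`) and `∂* = (∂)ᴴ` (vector → scalar) against King's staircases, EXACTLY, in divergence form with the two in-cell
# profiles `π^L`, `π^F` of `StaircaseLaplacianDefect`

Unit `b2b-balaban-gan24-p2` (gen 29), BINDER row G-an2-4 ∕ (CONV-C), road P2.  The two-level census of Bałaban's `Δ_a = Δ − ∂P∂* + aQ*Q`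
(1.69) at `U = 1` needs, besides the Laplacian (`StaircaseLaplacianDefect`, `StaircaseLaplacianDefectVec`) and the mass term
(`StaircaseLineSumDefect` + NE2's `LineAveragingPairing`), how the gradient `∂` and the divergence `∂*` pass King's staircases (`J` on
scalars, `J⊗1 := fun i ↦ A (par i.1, i.2)` on vector fields).  The first-order facts are `StaircaseLaplacianDefect.sdiff_mulVec_stair`
(`∂′_μ(Jλ) = R·𝟙_far·J(∂_μλ)`) and `sdiffH_mulVec_stair` (`∂′_μᴴ(Jg) = R·𝟙_near·J(∂_μᴴg)`); THIS FILE writes their defects in DIVERGENCE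
form (so that a propagator to the left sees an `O(η)` source under one more derivative):
 * §1 the general profile identities **`sdiffH_piL_stair_apply`** (`∂′_μᴴ(π^L_μ·Jg) = (R·𝟙_far − 1)·Jg`) and **`sdiffH_piF_stair_apply`**
   (`∂′_μᴴ(π^F_μ·Jg) = (R·𝟙_near − 1)·Jg`) for EVERY coarse field `g` (the special cases `g = ∂_μu`, `g = ∂_μᴴ∂_μu` are §4 of
   `StaircaseLaplacianDefect`);
 * §2 **`GradOp_stair_defect`** — `(∂′(Jλ))(x′, μ) − (∂λ)(par x′, μ) = ∂′_μᴴ(π^L_μ·J(∂_μλ))(x′)`;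
 * §3 **`GradOpH_stairV_defect`** — `(∂′*((J⊗1)A))(x′) − (∂*A)(par x′) = Σ_μ ∂′_μᴴ(π^F_μ·J(∂_μᴴA_μ))(x′)`.
HONEST SCOPE.  Exact finite-lattice algebra, every `d`, `N, R ≥ 1`, every torus; [folklore], kernel-checked, no `sorry`, no `def`; nothing of
Bałaban's asserted ([Balaban1984PropagatorsI] (1.4) p. 18 is a TEXT LOCATION for `∂`).  NOT (CONV-C), NEVER «G-an2-4 closed», NOT NE2, NOT D1,
NOT BetaPertH, NOT continuum, NOT Clay; not in print — our bookkeeping.  HONEST DEPENDENCY: continuum YM on T⁴ ⇐ BetaPertH ∧ nine spine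
estimates (0/9 proved); BetaPertH ⇐ (D1) ∧ (D4) ∧ CAP+tail; G-an2-4 gates asym, D1 and NE2/3/4.
-/

noncomputable section

open scoped BigOperators ComplexConjugate Matrix

namespace Summit.QuantumFields.BalabanUV.Beta.GAN24.StaircaseGradDivDefect

open Literature.MathematicalPhysics.QuantumFieldTheory.Balaban1983to89
open B5Prop11Plancherel (Tor fine unitVec)
open B5Action121 (sdiff GradOp comp divS GradOp_mulVec GradOp_conjTranspose_mulVec)
open Summit.QuantumFields.BalabanUV.T4Continuum.BalabanAveragedTowerModes (par)
open Summit.QuantumFields.BalabanUV.Beta.GAN24.StaircaseLaplacianDefect (stair stair_mulVec piL piF dpiL dpiF piL_sub_of_near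
  piF_sub_of_near sdiffH_mulVec_mul sdiff_mulVec_stair sdiffH_mulVec_stair)

variable {d : ℕ} (N R : ℕ) [NeZero N] [NeZero R] (M : Fin d → ℕ) [hM : ∀ μ, NeZero (M μ)]

/-! ## §1 The profile identities for a general coarse field -/

/-- **`∂′_μᴴ(π^L_μ·Jg)(x′) = (R·𝟙_far(x′) − 1)·g(par x′)`** for every coarse field `g`. [folklore] -/
theorem sdiffH_piL_stair_apply (μ : Fin d) (g : Tor (fine N M) → ℂ) (x : Tor (fine (R * N) M)) :
    ((sdiff (fine (R * N) M) ((R * N : ℕ) : ℂ) μ)ᴴ *ᵥ (fun z => piL N R M μ z * (stair N R M *ᵥ g) z)) x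
      = ((R : ℂ) * (if R ∣ (x μ).val + 1 then 1 else 0) - 1) * g (par N R M x) := by
  rw [sdiffH_mulVec_mul]
  dsimp only
  rw [dpiL, sdiffH_mulVec_stair, stair_mulVec]
  by_cases hnear : R ∣ (x μ).val
  · rw [piL_sub_of_near N R M μ x hnear]; ring
  · rw [if_neg hnear]; ring

/-- **`∂′_μᴴ(π^F_μ·Jg)(x′) = (R·𝟙_near(x′) − 1)·g(par x′)`** for every coarse field `g`. [folklore] -/
theorem sdiffH_piF_stair_apply (μ : Fin d) (g : Tor (fine N M) → ℂ) (x : Tor (fine (R * N) M)) :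
    ((sdiff (fine (R * N) M) ((R * N : ℕ) : ℂ) μ)ᴴ *ᵥ (fun z => piF N R M μ z * (stair N R M *ᵥ g) z)) x
      = ((R : ℂ) * (if R ∣ (x μ).val then 1 else 0) - 1) * g (par N R M x) := by
  rw [sdiffH_mulVec_mul]
  dsimp only
  rw [dpiF, sdiffH_mulVec_stair, stair_mulVec]
  by_cases hnear : R ∣ (x μ).val
  · rw [piF_sub_of_near N R M μ x hnear]; ring
  · rw [if_neg hnear, if_neg hnear]; ring

/-! ## §2 The gradient against the staircase -/

/-- **THE GRADIENT DEFECT, EXACTLY**: `(∂′(Jλ))(x′, μ) − (∂λ)(par x′, μ) = ∂′_μᴴ(π^L_μ·J(∂_μλ))(x′)` (`∂′_μ(Jλ) = R·𝟙_far·J(∂_μλ)`).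
[folklore] -/
theorem GradOp_stair_defect (lam : Tor (fine N M) → ℂ) (x : Tor (fine (R * N) M)) (μ : Fin d) :
    (GradOp (fine (R * N) M) ((R * N : ℕ) : ℂ) *ᵥ (stair N R M *ᵥ lam)) (x, μ) - (GradOp (fine N M) ((N : ℕ) : ℂ) *ᵥ lam) (par N R M x, μ)
      = ((sdiff (fine (R * N) M) ((R * N : ℕ) : ℂ) μ)ᴴ *ᵥ
          (fun z => piL N R M μ z * (stair N R M *ᵥ (sdiff (fine N M) ((N : ℕ) : ℂ) μ *ᵥ lam)) z)) x := by
  rw [GradOp_mulVec, GradOp_mulVec, sdiff_mulVec_stair, sdiffH_piL_stair_apply]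
  split_ifs <;> ring

/-! ## §3 The divergence against the componentwise staircase -/

omit [NeZero R] in
/-- the `μ`-component of `(J⊗1)A` is `J(A_μ)`. [folklore] -/
theorem comp_stairV (A : Tor (fine N M) × Fin d → ℂ) (μ : Fin d) :
    comp (fine (R * N) M) (fun i : Tor (fine (R * N) M) × Fin d => A (par N R M i.1, i.2)) μ = stair N R M *ᵥ comp (fine N M) A μ := by
  funext z
  simp only [comp, stair_mulVec]

/-- **THE DIVERGENCE DEFECT, EXACTLY**: `(∂′*((J⊗1)A))(x′) − (∂*A)(par x′) = Σ_μ ∂′_μᴴ(π^F_μ·J(∂_μᴴA_μ))(x′)`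
(`∂′_μᴴ(Jg) = R·𝟙_near·J(∂_μᴴg)` componentwise). [folklore] -/
theorem GradOpH_stairV_defect (A : Tor (fine N M) × Fin d → ℂ) (x : Tor (fine (R * N) M)) :
    ((GradOp (fine (R * N) M) ((R * N : ℕ) : ℂ))ᴴ *ᵥ (fun i : Tor (fine (R * N) M) × Fin d => A (par N R M i.1, i.2))) x
        - ((GradOp (fine N M) ((N : ℕ) : ℂ))ᴴ *ᵥ A) (par N R M x)
      = ∑ μ, ((sdiff (fine (R * N) M) ((R * N : ℕ) : ℂ) μ)ᴴ *ᵥ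
          (fun z => piF N R M μ z * (stair N R M *ᵥ ((sdiff (fine N M) ((N : ℕ) : ℂ) μ)ᴴ *ᵥ comp (fine N M) A μ)) z)) x := by
  rw [GradOp_conjTranspose_mulVec, GradOp_conjTranspose_mulVec, divS, divS, Finset.sum_apply, Finset.sum_apply,
    ← Finset.sum_sub_distrib]
  refine Finset.sum_congr rfl fun μ _ => ?_
  rw [comp_stairV, sdiffH_mulVec_stair, sdiffH_piF_stair_apply]
  split_ifs <;> ring

end Summit.QuantumFields.BalabanUV.Beta.GAN24.StaircaseGradDivDefect

end
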